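import Summits.ResolutionOfSingularities.ResolutionOfSingularities.Theorems.EquisingularLiftEquisingularLiftNatTowerBAwayTransport
import Summits.ResolutionOfSingularities.ResolutionOfSingularities.Theorems.EquisingularLiftEquisingularLiftNatTransversalStrictTransformRegular
import Summits.ResolutionOfSingularities.ResolutionOfSingularities.Theorems.EquisingularLiftEquisingularLiftNatRegularOfSpecialFibre
import Summits.ResolutionOfSingularities.ResolutionOfSingularities.Theorems.EquisingularLiftEquisingularLiftNatModelStep
import Literature.AlgebraicGeometry.Resolution.StrictNormalCrossingsFromRegularSequences
import Literature.AlgebraicGeometry.Resolution.StalkIdealLemmas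
import Literature.AlgebraicGeometry.Resolution.MarkedIdealsArithmetic
import Literature.AlgebraicGeometry.Resolution.CanonicalResolutionSmoothCentre
import Literature.AlgebraicGeometry.Resolution.RegularLocalRingsQuotient
import Literature.AlgebraicGeometry.Resolution.KollarBlowupSequenceFunctors
import Literature.AlgebraicGeometry.Resolution.BlowupSNC
import HarnessLib

/-!
# [OURS · L1 W4.5(b) · EL♮(3) · T23-A′ brick (A′-1) v2] Transversal member ⟹ simple normal crossings of the round's centre with the
# retained member, read off the special-fibre traces (`…NatTransversalHasSNCWithOfTrace`)

Crux chain w45b (cell `res-hironaka`, slot W4.5(b)), child **EL♮(3)** = stmt-ResolutionOfSingularities-20148, line `sections`,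
TWENTY-SEVENTH registration; engine widening **T23-A′ «B-TRACE»** (transversal round transport of a retained member `V(𝓕)` of the boundary
list whose special-fibre trace `F` is CROSSED by the round's downstairs centre `Z`) — engine owner res-L1-w45b-stub-4 g10, SIG v2
`L/res-L1-w45b-stub-4/T23Aprime-TransversalTransport.sig.v2.lean` sha16 767f3543c2b2e4ae (desk g19 R12′ (ii), ACK l.78852). THIS FILE = brick
**(A′-1) v2** `hasSNCWith_member_centre_of_trace_transversal` (signature VERBATIM from the SIG) and its **local lemma**
`isRegularLocalRing_quotient_sup_span_singleton_of_sup_eq_maximalIdeal`; (A′-2) = p606871 consumes `HasSNCWith [𝓕] C` to keep the strict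
transform of `V(𝓕)` regular. Written by res-L1-w45b-lead-2 g5 (text owner acting as free kernel hand). HONEST FRAMING: OURS; replaces the
role of NOTHING printed in H. Hironaka's 2017 manuscript and is NOT a statement of it; AI-written, gate-checked, weaker than expert review.
No `sorry`; standard axioms; DEF-FREE. `--supports stmt-ResolutionOfSingularities-20148 --as helper`.

WHY v2 (stub-4's witness, recorded in the SIG): the v1 hypotheses «`Z ∩ F` finite and `𝓘⟨Z⟩ ⊔ 𝓘⟨F⟩ = 𝓘⟨Z ∩ F⟩`» are satisfied by
`X = 𝔸²_O ∋ (s, t)`, `C = (s, t)` (a section), `𝓕 = (s − ϖ²)`, where `C ⊔ 𝓕 = (s, t, ϖ²)` is not a part of a regular system of parameters —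
the traces cannot see the order of contact in the `ϖ`-direction. What saves CURVE centres is that `Z` is one-dimensional at the crossing:
(T1) `𝓘⟨Z⟩_g ⊔ 𝓘⟨F⟩_g = 𝔪_{G,g}` (reduced isolated crossing) AND (T2) `𝓘⟨Z⟩_g ≠ 𝔪_{G,g}` (g not isolated in `Z`) at every `g ∈ Z ∩ F`.

PROOF. `hasSNCWith_of_nonZeroDivisor_data` (Literature `StrictNormalCrossingsFromRegularSequences`, BGMW Def. 3.1.3 (2) verified
through regular sequences) with the one-member list `E = [𝓕]` and the local equation `f_x` := a generator of the principal stalk `𝓕_x` asks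
for: `𝒪_{X,x}` and `𝒪_{X,x}/(f_x)` regular and `f_x` a non-zero-divisor (X regular, `V(𝓕)` regular, X integral with `𝓕 ≠ ⊥`); and at the points
of `V(C)`: `𝒪_{X,x}/C_x` regular with `f_x` a non-zero-divisor when `f_x ∉ C_x` (regular local rings are domains), and `𝒪_{X,x}/(C_x + (f_x))`
regular when `f_x ∉ C_x`. The last is «`V(C ⊔ 𝓕)` is a regular scheme», which by `Scheme.isRegular_subscheme_of_forall_over_closedPoint`
(…NatRegularOfSpecialFibre: `V(C ⊔ 𝓕)` is proper over the local `O`) needs checking only at points over the closed point, i.e. at `x = jG g`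
(model square). There `φ = jG_g^♯ : 𝒪_{X,x} ↠ 𝒪_{G,g}` carries `C_x ↦ 𝓘⟨Z⟩_g`, `𝓕_x ↦ 𝓘⟨F⟩_g` (`stalkIdeal_comap_eq_map_stalkMap` with the
trace hypotheses), so (T1)/(T2) pull back to `C_x ⊔ (f_x) ⊔ ker φ = 𝔪_x` and `C_x ⊔ ker φ ≠ 𝔪_x`, and the LOCAL LEMMA concludes: in the
regular local ring `B = 𝒪_{X,x}/C_x`, `(f̄) + K̄ = 𝔪_B` with `K̄ ≠ 𝔪_B` forces `f̄ ∉ 𝔪_B²` (Nakayama), hence `B/(f̄)` regular (Matsumura 14.2,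
tree `IsRegularLocalRing.quotient_span_singleton`).

References (method / index only): E. Bierstone, D. Grigoriev, P. Milman, J. Włodarczyk (2011), Def. 3.1.3 (2); H. Matsumura, *Commutative
Ring Theory* (1986), Thm. 2.2 (Nakayama), Thm. 14.2.
-/

set_option linter.dupNamespace false -- mandated namespace `Summit.<Summit>.<Problem>` of this single-conjunct summit

noncomputable section

open CategoryTheory CategoryTheory.Limits AlgebraicGeometry TopologicalSpace Topology IsLocalRing
open Literature.AlgebraicGeometry.Resolution
open AlgebraicGeometry.Scheme.IdealSheafData

namespace Summit.ResolutionOfSingularities.ResolutionOfSingularities.Cruxes.EquisingularLiftNat.Sections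

/-! ## The local lemma -/

/-- **LOCAL LEMMA (Nakayama).** Let `A` be a Noetherian local ring, `P, K ⊆ A` ideals and `f ∈ A` with `A ⧸ P` a regular local ring,
`P ⊔ (f) ⊔ K = 𝔪_A` and `P ⊔ K ≠ 𝔪_A`. Then `A ⧸ (P ⊔ (f))` is a regular local ring: in `B = A ⧸ P` one has `(f̄) + K̄ = 𝔪_B` and
`K̄ ≠ 𝔪_B`, so `f̄ ∉ 𝔪_B²` (else `𝔪_B = K̄ + 𝔪_B²`, i.e. `𝔪_B = K̄` by Nakayama), and the quotient of a regular local ring by an element of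
`𝔪 ∖ 𝔪²` is regular. [cite: Matsumura1987, Thm. 14.2 with Thm. 2.2 (Nakayama)] -/
theorem isRegularLocalRing_quotient_sup_span_singleton_of_sup_eq_maximalIdeal {A : Type} [CommRing A] [IsLocalRing A]
    [IsNoetherianRing A] (P K : Ideal A) (f : A) [IsRegularLocalRing (A ⧸ P)]
    (h1 : P ⊔ Ideal.span {f} ⊔ K = maximalIdeal A) (h2 : P ⊔ K ≠ maximalIdeal A) :
    IsRegularLocalRing (A ⧸ (P ⊔ Ideal.span {f})) := by
  set π : A →+* A ⧸ P := Ideal.Quotient.mk P with hπ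
  have hπs : Function.Surjective π := Ideal.Quotient.mk_surjective
  -- the images in `B = A ⧸ P`
  have hmapP : P.map π = ⊥ := by rw [hπ, Ideal.map_quotient_self]
  have hmapm : (maximalIdeal A).map π = maximalIdeal (A ⧸ P) := IsLocalRing.map_maximalIdeal_of_surjective π hπs
  have hcomapm : (maximalIdeal (A ⧸ P)).comap π = maximalIdeal A := by
    haveI := IsLocalHom.of_surjective π hπs
    exact IsLocalRing.maximalIdeal_comap π
  have hker : Ideal.comap π ⊥ = P := by
    rw [← RingHom.ker_eq_comap_bot, hπ, Ideal.mk_ker]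
  have h1' : Ideal.span {π f} ⊔ K.map π = maximalIdeal (A ⧸ P) := by
    have := congrArg (Ideal.map π) h1
    rwa [Ideal.map_sup, Ideal.map_sup, hmapP, bot_sup_eq, Ideal.map_span, Set.image_singleton, hmapm] at this
  have h2' : K.map π ≠ maximalIdeal (A ⧸ P) := by
    intro h
    apply h2
    have := congrArg (Ideal.comap π) h
    rwa [Ideal.comap_map_of_surjective π hπs, hker, hcomapm, sup_comm] at this
  -- `f̄ ∈ 𝔪_B ∖ 𝔪_B²`
  have hfm : π f ∈ maximalIdeal (A ⧸ P) := by
    rw [← h1']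
    exact Ideal.mem_sup_left (Ideal.subset_span rfl)
  have hKle : K.map π ≤ maximalIdeal (A ⧸ P) := by
    rw [← h1']; exact le_sup_right
  have hfm2 : π f ∉ (maximalIdeal (A ⧸ P)) ^ 2 := by
    intro hf2
    apply h2'
    refine le_antisymm hKle ?_
    -- Nakayama: `𝔪 ≤ K̄ ⊔ 𝔪 • 𝔪` forces `𝔪 ≤ K̄`
    refine Submodule.le_of_le_smul_of_le_jacobson_bot (IsNoetherian.noetherian _)
      (IsLocalRing.maximalIdeal_le_jacobson ⊥) ?_
    calc maximalIdeal (A ⧸ P) = Ideal.span {π f} ⊔ K.map π := h1'.symm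
      _ ≤ (maximalIdeal (A ⧸ P)) ^ 2 ⊔ K.map π := sup_le_sup_right ((Ideal.span_singleton_le_iff_mem _).mpr hf2) _
      _ = K.map π ⊔ maximalIdeal (A ⧸ P) • maximalIdeal (A ⧸ P) := by rw [sup_comm, pow_two, Ideal.smul_eq_mul]
  -- `B ⧸ (f̄)` is regular, and it is `A ⧸ (P ⊔ (f))`
  have hreg : IsRegularLocalRing ((A ⧸ P) ⧸ Ideal.span {π f}) := (IsRegularLocalRing.quotient_span_singleton hfm hfm2).1
  have hspan : (Ideal.span {f}).map π = Ideal.span {π f} := by rw [Ideal.map_span, Set.image_singleton]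
  haveI : IsRegularLocalRing ((A ⧸ P) ⧸ (Ideal.span {f}).map π) := isRegularLocalRing_quotient_of_eq hspan.symm hreg
  exact IsRegularLocalRing.of_ringEquiv (DoubleQuot.quotQuotEquivQuotSup P (Ideal.span {f}))

/-! ## (A′-1) v2 -/

variable {O : Type} [CommRing O] [IsDomain O] [IsDiscreteValuationRing O] {k : Type} [Field k] {θ : O →+* k}
  {P : Scheme.{0}} {q : P ⟶ Spec (.of O)}
  {G G' X X₂ : Scheme.{0}} {σ : X ⟶ P} {jG : G ⟶ X} {tG : G ⟶ Spec (.of k)}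
  {C 𝓕 : X.IdealSheafData} {τ : X₂ ⟶ X} {υ₂ : G' ⟶ G} {j₂ : G' ⟶ X₂} {t₂ : G' ⟶ Spec (.of k)}
  {Z F : Set G} {hZ : IsClosed Z} {hF : IsClosed F}

/-- **(A′-1) v2 — a retained member crossed transversally by the round's centre has simple normal crossings with it** (T23-A′ «B-TRACE»,
SIG v2 767f3543c2b2e4ae verbatim).  For: the stage `σ : X ⟶ P` over `q : P ⟶ Spec O` (`X` regular, locally Noetherian, integral, proper
over `O`) with model square `(jG, tG)` over the residue surjection `θ : O ↠ k`; the centre `C` (regular closed subscheme) with reduced trace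
`C·𝒪_G = 𝓘⟨Z⟩`; the member `𝓕 ≠ ⊥` (principal stalks, regular closed subscheme) with reduced trace `𝓕·𝒪_G = 𝓘⟨F⟩`; and at every crossing
point `g ∈ Z ∩ F` the stalkwise conditions (T1) `𝓘⟨Z⟩_g ⊔ 𝓘⟨F⟩_g = 𝔪_{G,g}` and (T2) `𝓘⟨Z⟩_g ≠ 𝔪_{G,g}`.  CONCLUSION: `HasSNCWith [𝓕] C`
(BGMW Def. 3.1.3 (2)): the input of (A′-2) p606871 `isRegular_subscheme_strictTransformIdeal_of_hasSNCWith`. See the module docstring for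
the proof. [cite: BierstoneGrigorievMilmanWlodarczyk2011, Def. 3.1.3 (2)] [OURS · L1 W4.5b · T23-A′ (A′-1)]; NOT a statement of the manuscript. -/
theorem hasSNCWith_member_centre_of_trace_transversal [IsLocallyNoetherian X] [IsIntegral X] (hXreg : Scheme.IsRegular X)
    (hsq : IsPullback jG tG (σ ≫ q) (Spec.map (CommRingCat.ofHom θ))) (hθ : Function.Surjective θ) [IsProper (σ ≫ q)]
    (hC : C.comap jG = vanishingIdeal ⟨Z, hZ⟩) (hCreg : Scheme.IsRegular C.subscheme)
    (hF1 : 𝓕.comap jG = vanishingIdeal ⟨F, hF⟩) (hF2 : ∀ z : X, (stalkIdeal 𝓕 z).IsPrincipal) (hF3 : Scheme.IsRegular 𝓕.subscheme)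
    (h𝓕0 : 𝓕 ≠ ⊥)
    (hT1 : ∀ g ∈ Z ∩ F, stalkIdeal (vanishingIdeal (⟨Z, hZ⟩ : Closeds G)) g ⊔ stalkIdeal (vanishingIdeal (⟨F, hF⟩ : Closeds G)) g =
      maximalIdeal (G.presheaf.stalk g))
    (hT2 : ∀ g ∈ Z ∩ F, stalkIdeal (vanishingIdeal (⟨Z, hZ⟩ : Closeds G)) g ≠ maximalIdeal (G.presheaf.stalk g)) :
    HasSNCWith [𝓕] C := by
  classical
  -- local equations: a generator of the principal stalk `𝓕_x`
  let f : ∀ x : X, X.IdealSheafData → X.presheaf.stalk x := fun x _ => Submodule.IsPrincipal.generator (stalkIdeal 𝓕 x)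
  have hf : ∀ x : X, stalkIdeal 𝓕 x = Ideal.span {f x 𝓕} := fun x => by
    haveI := hF2 x
    exact (Ideal.span_singleton_generator (stalkIdeal 𝓕 x)).symm
  have hf0 : ∀ x : X, f x 𝓕 ≠ 0 := fun x h0 => by
    apply stalkIdeal_ne_bot_of_ne_bot h𝓕0 x
    rw [hf x, h0, Ideal.span_singleton_eq_bot]
  -- support bookkeeping
  have hsuppCF : ∀ x : X, x ∈ ((C ⊔ 𝓕).support : Set X) ↔ x ∈ (C.support : Set X) ∧ x ∈ (𝓕.support : Set X) := fun x => by
    rw [Scheme.IdealSheafData.support_sup, Closeds.coe_inf, Set.mem_inter_iff]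
  have hsuppZ : ((vanishingIdeal ⟨Z, hZ⟩ : G.IdealSheafData).support : Set G) = Z :=
    Scheme.IdealSheafData.coe_support_vanishingIdeal _
  have hsuppF : ((vanishingIdeal ⟨F, hF⟩ : G.IdealSheafData).support : Set G) = F :=
    Scheme.IdealSheafData.coe_support_vanishingIdeal _
  -- the model square: `jG` is a closed immersion onto the special fibre
  haveI : IsClosedImmersion (Spec.map (CommRingCat.ofHom θ)) := IsClosedImmersion.spec_of_surjective _ hθ
  haveI hjci : IsClosedImmersion jG := MorphismProperty.IsStableUnderBaseChange.of_isPullback hsq.flip inferInstance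
  -- KEY: `V(C ⊔ 𝓕)` is a regular scheme (checked over the closed point of `Spec O`)
  have hreg2 : Scheme.IsRegular (C ⊔ 𝓕).subscheme := by
    refine Scheme.isRegular_subscheme_of_forall_over_closedPoint (σ ≫ q) (C ⊔ 𝓕) fun x hx hqx => ?_
    have hxr : x ∈ Set.range jG := by
      rw [range_eq_preimage_of_isPullback hsq, range_specMap_of_surjective_of_field θ hθ]; exact hqx
    obtain ⟨g, rfl⟩ := hxr
    obtain ⟨hxC, hxF⟩ := (hsuppCF _).mp hx
    have hgZ : g ∈ Z := by
      have h1 : g ∈ ((C.comap jG).support : Set G) := by rw [support_comap]; exact hxC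
      rwa [hC, hsuppZ] at h1
    have hgF : g ∈ F := by
      have h1 : g ∈ ((𝓕.comap jG).support : Set G) := by rw [support_comap]; exact hxF
      rwa [hF1, hsuppF] at h1
    haveI hPreg : IsRegularLocalRing (X.presheaf.stalk (jG g) ⧸ stalkIdeal C (jG g)) :=
      isRegularLocalRing_stalk_quotient_stalkIdeal hCreg hxC
    rw [stalkIdeal_sup, hf]
    by_cases hfC : f (jG g) 𝓕 ∈ stalkIdeal C (jG g)
    · -- `C_x ⊔ (f) = C_x`
      have heq : stalkIdeal C (jG g) = stalkIdeal C (jG g) ⊔ Ideal.span {f (jG g) 𝓕} :=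
        (sup_eq_left.mpr ((Ideal.span_singleton_le_iff_mem _).mpr hfC)).symm
      exact isRegularLocalRing_quotient_of_eq heq hPreg
    · -- the local lemma with `K = ker jG_g^♯`
      set φ : X.presheaf.stalk (jG g) →+* G.presheaf.stalk g := (jG.stalkMap g).hom with hφ
      have hφs : Function.Surjective φ := jG.stalkMap_surjective g
      have hZg : stalkIdeal (vanishingIdeal (⟨Z, hZ⟩ : Closeds G)) g = (stalkIdeal C (jG g)).map φ := by
        rw [← hC, stalkIdeal_comap_eq_map_stalkMap]
      have hFg : stalkIdeal (vanishingIdeal (⟨F, hF⟩ : Closeds G)) g = (Ideal.span {f (jG g) 𝓕}).map φ := by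
        rw [← hF1, stalkIdeal_comap_eq_map_stalkMap, hf]
      have h1 := hT1 g ⟨hgZ, hgF⟩
      have h2 := hT2 g ⟨hgZ, hgF⟩
      rw [hZg, hFg, ← Ideal.map_sup] at h1
      rw [hZg] at h2
      have hcomapm : (maximalIdeal (G.presheaf.stalk g)).comap φ = maximalIdeal (X.presheaf.stalk (jG g)) :=
        IsLocalRing.maximalIdeal_comap φ
      refine isRegularLocalRing_quotient_sup_span_singleton_of_sup_eq_maximalIdeal (stalkIdeal C (jG g)) (Ideal.comap φ ⊥)
        (f (jG g) 𝓕) ?_ ?_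
      · have := congrArg (Ideal.comap φ) h1
        rwa [Ideal.comap_map_of_surjective φ hφs, hcomapm] at this
      · intro heq
        apply h2
        have := congrArg (Ideal.map φ) heq
        rwa [Ideal.map_sup, Ideal.map_comap_of_surjective φ hφs, sup_bot_eq,
          IsLocalRing.map_maximalIdeal_of_surjective φ hφs] at this
  -- membership in the one-member list
  have hmem : ∀ {D : X.IdealSheafData}, D ∈ [𝓕] ↔ D = 𝓕 := fun {D} => List.mem_singleton
  have hTsub : ∀ (T : Finset X.IdealSheafData), (∀ D ∈ T, D ∈ [𝓕]) → T = ∅ ∨ T = {𝓕} := fun T hT =>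
    Finset.subset_singleton_iff.mp fun D hD => by rw [Finset.mem_singleton]; exact hmem.mp (hT D hD)
  refine hasSNCWith_of_nonZeroDivisor_data [𝓕] C f ?_ ?_ ?_
  · -- (1) principal stalks
    intro x D hD _
    rw [hmem.mp hD]
    exact hf x
  · -- (2) the member alone: `𝒪_x`, `𝒪_x/(f)` regular, `f` a non-zero-divisor
    intro x T hT
    rcases hTsub T (fun D hD => (hT D hD).1) with rfl | rfl
    · refine ⟨?_, ?_⟩
      · have h0 : (⊥ : Ideal (X.presheaf.stalk x)) = Ideal.span (f x '' ((∅ : Finset X.IdealSheafData) : Set X.IdealSheafData)) := by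
          rw [Finset.coe_empty, Set.image_empty, Ideal.span_empty]
        haveI := hXreg x
        exact isRegularLocalRing_quotient_of_eq h0 (IsRegularLocalRing.of_ringEquiv (RingEquiv.quotientBot (X.presheaf.stalk x)).symm)
      · intro D hD _ _
        rw [hmem.mp hD]
        have h0 : (⊥ : Ideal (X.presheaf.stalk x)) = Ideal.span (f x '' ((∅ : Finset X.IdealSheafData) : Set X.IdealSheafData)) := by
          rw [Finset.coe_empty, Set.image_empty, Ideal.span_empty]
        refine mem_nonZeroDivisors_mk_of_eq h0 (mem_nonZeroDivisors_of_ne_zero ?_)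
        rw [Ne, Ideal.Quotient.eq_zero_iff_mem, Ideal.mem_bot]
        exact hf0 x
    · refine ⟨?_, ?_⟩
      · have hx : x ∈ (𝓕.support : Set X) := (hT 𝓕 (Finset.mem_singleton_self _)).2
        have h0 : stalkIdeal 𝓕 x = Ideal.span (f x '' (({𝓕} : Finset X.IdealSheafData) : Set X.IdealSheafData)) := by
          rw [Finset.coe_singleton, Set.image_singleton, hf]
        exact isRegularLocalRing_quotient_of_eq h0 (isRegularLocalRing_stalk_quotient_stalkIdeal hF3 hx)
      · intro D hD _ hDT
        exact absurd (Finset.mem_singleton.mpr (hmem.mp hD)) hDT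
  · -- (3) at the points of the centre
    intro x hxC T hT
    haveI hPreg : IsRegularLocalRing (X.presheaf.stalk x ⧸ stalkIdeal C x) := isRegularLocalRing_stalk_quotient_stalkIdeal hCreg hxC
    rcases hTsub T (fun D hD => (hT D hD).1) with rfl | rfl
    · refine ⟨?_, ?_⟩
      · have h0 : stalkIdeal C x = stalkIdeal C x ⊔ Ideal.span (f x '' ((∅ : Finset X.IdealSheafData) : Set X.IdealSheafData)) := by
          rw [Finset.coe_empty, Set.image_empty, Ideal.span_empty, sup_bot_eq]
        exact isRegularLocalRing_quotient_of_eq h0 hPreg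
      · intro D hD _ hfC _
        rw [hmem.mp hD] at hfC ⊢
        have h0 : stalkIdeal C x = stalkIdeal C x ⊔ Ideal.span (f x '' ((∅ : Finset X.IdealSheafData) : Set X.IdealSheafData)) := by
          rw [Finset.coe_empty, Set.image_empty, Ideal.span_empty, sup_bot_eq]
        haveI : IsDomain (X.presheaf.stalk x ⧸ stalkIdeal C x) := isDomain_of_isRegularLocalRing _
        refine mem_nonZeroDivisors_mk_of_eq h0 (mem_nonZeroDivisors_of_ne_zero ?_)
        rw [Ne, Ideal.Quotient.eq_zero_iff_mem]
        exact hfC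
    · refine ⟨?_, ?_⟩
      · obtain ⟨-, hxF, -⟩ := hT 𝓕 (Finset.mem_singleton_self _)
        have hx2 : x ∈ ((C ⊔ 𝓕).support : Set X) := (hsuppCF x).mpr ⟨hxC, hxF⟩
        have h0 : stalkIdeal (C ⊔ 𝓕) x = stalkIdeal C x ⊔ Ideal.span (f x '' (({𝓕} : Finset X.IdealSheafData) : Set X.IdealSheafData)) := by
          rw [Finset.coe_singleton, Set.image_singleton, stalkIdeal_sup, hf]
        exact isRegularLocalRing_quotient_of_eq h0 (isRegularLocalRing_stalk_quotient_stalkIdeal hreg2 hx2)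
      · intro D hD _ _ hDT
        exact absurd (Finset.mem_singleton.mpr (hmem.mp hD)) hDT

end Summit.ResolutionOfSingularities.ResolutionOfSingularities.Cruxes.EquisingularLiftNat.Sections

end
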